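import Mathlib.FieldTheory.Galois.NormalBasis
import Mathlib.FieldTheory.Fixed
import Mathlib.LinearAlgebra.Matrix.NonsingularInverse
import Summits.BirchSwinnertonDyer.Rank1Residual.GaloisImage.ModPLatticeHerbrandIterate
import Summits.BirchSwinnertonDyer.Rank1Residual.GaloisImage.LocalOneUnitsModPCount
import HarnessLib

/-!
# The normal-basis lattice `⊕_σ 𝒪_K · σx ≤ 𝒪_E` and free `G`-modules modulo `p`
# (cell `b2b-bsdres`, team n1011, row T-EPC = Tate's local Euler–Poincaré characteristic; seat p04 GEN 8; stage B6a)

HONEST FRAMING (cell `b2b-bsdres`, run/shared/lean/b2b/bsd-rank1-residual/, verbatim in every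
file): the goal of the cell is to DELETE the COMBINATION-SHAPED residual classes of the
Birch–Swinnerton-Dyer formula for ALL analytic-rank `≤ 1` elliptic curves over `ℚ` — "full BSD
formula for every rank `≤ 1` curve in class `C`" assembled STRICTLY from published theorems — so
that the rank-`≤ 1` remainder becomes exactly the CONSTRUCTION-SHAPED classes, which are TYPED
(missing-input `Prop`s), NOT attempted. This is not "finishing BSD". Team n1011 (N10 / N11, the
additive block X4 ∧ `p = 3`): research route; no claim beyond the stated classes; nothing is
booked; no mark / label is changed by this file. Theorems only (no definition, no named fact, no
`sorry`); TOOL theorems on local fields.  (Placement: Summits/GaloisImage, as stages A1–B5b.)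

## What

Milne, *Arithmetic Duality Theorems*, I §2, proof of Thm. 2.8, after Lemma 2.12: "The normal
basis theorem shows that `L ≈ ℚ_p[G] ⊗_{ℚ_p} K`, and so … `R_L^{(p)}` has the same class in
`R_{𝔽_p}(G)` as `𝔽_p[G] ⊗ R ⊗_{ℤ_p} 𝔽_p`" (`R = 𝒪_K`), i.e. `[R_L^{(p)}] = [K : ℚ_p][𝔽_p[G]]`.
This file supplies the two ingredients of that sentence in the counting currency of stage A1
(`#Hom_G(Z, ·)`, `Representation.IntertwiningMap`):

* `ModPRepCount.natCard_intertwiningMap_modP_of_free` — if `Y = ⊕_{g ∈ G} g · Y₀` is freely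
  generated over `G` by a subgroup `Y₀` (bijectivity of `(c_g) ↦ ∑ g c_g`), then so is `Y/pY` over
  the image of `Y₀`, which is `≃ Y₀/pY₀`; hence `#Hom_G(Z, Y/pY) = #Hom(Z, Y₀/pY₀)` (stage A1's
  Frobenius reciprocity count `natCard_intertwiningMap_of_free` modulo `p`);
* `LocalIntegers.exists_normalBasis_lattice` — for `E/K` finite Galois, `E` a non-archimedean local
  field of characteristic `0` with `|p| < 1` whose Galois group preserves the valuation: there are
  `x ∈ 𝒪_E` with `(σx)_σ` a `K`-basis of `E` (Mathlib's normal basis theorem `IsGalois.normalBasis`,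
  scaled into `𝒪_E`) and `N` with `p^N 𝒪_E ≤ ⊕_σ 𝒪_K σx`, where `𝒪_K = K ∩ 𝒪_E`
  (`a ∈ 𝒪_K ↔ algebraMap K E a ∈ 𝒪_E`): the coordinates of `y ∈ 𝒪_E` are `adj(A)·(τy)_τ / det A`
  for the matrix `A = (τσx)_{τ,σ}` with entries in `𝒪_E`, `det A ≠ 0` by Dedekind's independence of
  automorphisms, and `|p^N| < |det A|` for some `N` (`⋂ p^m 𝒪_E = 0`);
* `LocalIntegers.exists_submodule_integer`, `integer_le_comap`, `exists_submodule_integerBase` —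
  the membership-characterised `ℤ`-submodules `𝒪_E ≤ E` (Galois stable) and `𝒪_K ≤ K`.

The counts `#Hom_Δ(Z, 𝒪_E/p) = #Hom(Z, 𝒪_K/p)` and `#(𝒪_E/p) = #(𝒪_K/p)^{[E:K]}`, and the assembled
Lemma 2.11, are the sequel (stage B6b, `LocalIntegersNormalBasisCount`).

References: J. S. Milne, *Arithmetic Duality Theorems*, 2nd ed. (2006), I §2, proof of Thm. 2.8
(p. 34) [MilneADT2006]; E. Artin, *Galois Theory*, Thm. 12 (independence of characters) — Mathlib
`linearIndependent_toLinearMap`; the normal basis theorem — Mathlib `IsGalois.normalBasis`.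
-/

noncomputable section

open Function
open scoped ValuativeRel

namespace Summit.BirchSwinnertonDyer.Rank1Residual.GaloisImage

/-! ### Free `G`-modules modulo `p` -/

namespace ModPRepCount

open Representation

variable {G : Type*} [Group G] [Fintype G]
variable {Z : Type*} [AddCommGroup Z] (σ : Representation ℤ G Z)
variable {Y : Type*} [AddCommGroup Y] (τ : Representation ℤ G Y) (p : ℕ)

/-- If `Φ : (c_g)_g ↦ ∑_g g c_g : Y₀^G → Y` is bijective then `Φ (δ_1 y) = y` for `y ∈ Y₀`
(`δ_1` the function supported at `1`). [folklore] -/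
theorem apply_single_eq [DecidableEq G] (Y₀ : Submodule ℤ Y) (Φ : (G → Y₀) →+ Y)
    (hΦ : ∀ c, Φ c = ∑ g : G, τ g (c g : Y)) (y : Y₀) : Φ (Pi.single 1 y) = y := by
  rw [hΦ, Finset.sum_eq_single (1 : G)]
  · rw [Pi.single_eq_same, map_one, Module.End.one_apply]
  · intro g _ hg
    rw [Pi.single_eq_of_ne hg, Submodule.coe_zero, map_zero]
  · intro h; exact absurd (Finset.mem_univ _) h

/-- For `Φ` as above bijective: `y ∈ Y₀ ∩ pY` implies `y ∈ pY₀`. [folklore] -/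
theorem mem_range_lsmul_of_free (Y₀ : Submodule ℤ Y) (Φ : (G → Y₀) →+ Y)
    (hΦ : ∀ c, Φ c = ∑ g : G, τ g (c g : Y)) (hY : Bijective Φ) (y : Y₀)
    (hy : (y : Y) ∈ LinearMap.range (LinearMap.lsmul ℤ Y p)) :
    y ∈ LinearMap.range (LinearMap.lsmul ℤ Y₀ p) := by
  classical
  obtain ⟨y₁, hy₁⟩ := hy
  obtain ⟨c₁, rfl⟩ := hY.2 y₁
  rw [LinearMap.lsmul_apply, ← map_zsmul, ← apply_single_eq τ Y₀ Φ hΦ y] at hy₁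
  have h := congrFun (hY.1 hy₁) 1
  rw [Pi.smul_apply, Pi.single_eq_same] at h
  exact ⟨c₁ 1, by rw [LinearMap.lsmul_apply, h]⟩

/-- **Free `G`-modules stay free modulo `p`, counted**: if `Y = ⊕_{g ∈ G} g · Y₀` is freely generated
over `G` by the subgroup `Y₀` (`Φ : (c_g)_g ↦ ∑_g g c_g` bijective), then for every `G`-module `Z`
`#Hom_G(Z, Y/pY) = #Hom(Z, Y₀/pY₀)`: `Y/pY` is freely generated by the image `Y₀'` of `Y₀`, and
`Y₀' ≃ Y₀/pY₀` because `Y₀ ∩ pY = pY₀`.  (Milne: "`[𝔽_p[G] ⊗ R ⊗ 𝔽_p] = dim(R ⊗ 𝔽_p)·[𝔽_p[G]]`".)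
[cite: MilneADT2006, I §2 proof of Thm 2.8 (after Lemma 2.12, p. 34)] -/
theorem natCard_intertwiningMap_modP_of_free (Y₀ : Submodule ℤ Y) (Φ : (G → Y₀) →+ Y)
    (hΦ : ∀ c, Φ c = ∑ g : G, τ g (c g : Y)) (hY : Bijective Φ) :
    Nat.card (IntertwiningMap σ (τ.quotient _ (range_lsmul_le_comap τ p))) =
      Nat.card (Z →+ (Y₀ ⧸ LinearMap.range (LinearMap.lsmul ℤ Y₀ p))) := by
  classical
  set P : Submodule ℤ Y := LinearMap.range (LinearMap.lsmul ℤ Y p) with hP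
  set τQ := τ.quotient _ (range_lsmul_le_comap τ p) with hτQ
  have hτQ_mk : ∀ (g : G) (y : Y), τQ g (Submodule.Quotient.mk y) = Submodule.Quotient.mk (τ g y) :=
    fun g y => rfl
  -- the image of `Y₀` in `Y/pY`
  set Y₀' : Submodule ℤ (Y ⧸ P) := Y₀.map P.mkQ with hY₀'
  -- `Φ'`
  let Φ' : (G → Y₀'.toAddSubgroup) →+ (Y ⧸ P) :=
    { toFun := fun c => ∑ g : G, τQ g (c g : Y ⧸ P)
      map_zero' := by simp
      map_add' := fun c c' => by
        simp only [Pi.add_apply, AddSubgroup.coe_add, map_add, Finset.sum_add_distrib] }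
  have hΦ' : ∀ c, Φ' c = ∑ g : G, τQ g (c g : Y ⧸ P) := fun c => rfl
  -- reduction of `Φ`
  have hred : ∀ c : G → Y₀, P.mkQ (Φ c) = ∑ g : G, τQ g (P.mkQ (c g : Y)) := fun c => by
    rw [hΦ, map_sum]; rfl
  -- surjectivity
  have hsurj : Surjective Φ' := by
    intro q
    obtain ⟨y, rfl⟩ := Submodule.mkQ_surjective P q
    obtain ⟨c, rfl⟩ := hY.2 y
    refine ⟨fun g => ⟨P.mkQ (c g : Y), Submodule.mem_map_of_mem (c g).2⟩, ?_⟩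
    rw [hΦ', hred]
  -- injectivity
  have hinj : Injective Φ' := by
    rw [injective_iff_map_eq_zero]
    intro c' hc'
    have hlift : ∀ g, ∃ y : Y₀, P.mkQ (y : Y) = (c' g : Y ⧸ P) := fun g => by
      have h2 : (c' g : Y ⧸ P) ∈ Y₀' := (c' g).2
      obtain ⟨y, hy, hyg⟩ := Submodule.mem_map.1 h2
      exact ⟨⟨y, hy⟩, hyg⟩
    choose c hc using hlift
    have h0 : P.mkQ (Φ c) = 0 := by
      rw [hred, ← hc', hΦ']
      exact Finset.sum_congr rfl fun g _ => by rw [hc]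
    rw [Submodule.mkQ_apply, Submodule.Quotient.mk_eq_zero] at h0
    obtain ⟨y₁, hy₁⟩ := h0
    obtain ⟨c₁, rfl⟩ := hY.2 y₁
    rw [LinearMap.lsmul_apply, ← map_zsmul] at hy₁
    have hcc := hY.1 hy₁
    funext g
    apply Subtype.ext
    rw [← hc g, ← hcc]
    change P.mkQ ((p : ℤ) • (c₁ g : Y)) = 0
    rw [Submodule.mkQ_apply, Submodule.Quotient.mk_eq_zero]
    exact ⟨(c₁ g : Y), rfl⟩
  have key := natCard_intertwiningMap_of_free σ τQ Y₀'.toAddSubgroup Φ' hΦ' ⟨hinj, hsurj⟩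
  refine key.trans ?_
  -- `Y₀' ≃ Y₀ / pY₀`
  let π : Y₀ →ₗ[ℤ] Y₀' := LinearMap.codRestrict Y₀' (P.mkQ.domRestrict Y₀) fun y =>
    Submodule.mem_map_of_mem y.2
  have hπ : ∀ y : Y₀, (π y : Y ⧸ P) = P.mkQ (y : Y) := fun y => rfl
  have hπsurj : Surjective π := by
    rintro ⟨q, hq⟩
    obtain ⟨y, hy, rfl⟩ := Submodule.mem_map.1 hq
    exact ⟨⟨y, hy⟩, rfl⟩
  have hπker : LinearMap.ker π = LinearMap.range (LinearMap.lsmul ℤ Y₀ p) := by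
    apply le_antisymm
    · intro y hy
      rw [LinearMap.mem_ker] at hy
      have hy' : P.mkQ (y : Y) = 0 := by rw [← hπ, hy]; rfl
      rw [Submodule.mkQ_apply, Submodule.Quotient.mk_eq_zero] at hy'
      exact mem_range_lsmul_of_free τ p Y₀ Φ hΦ hY y hy'
    · rintro _ ⟨y, rfl⟩
      rw [LinearMap.mem_ker]
      apply Subtype.ext
      rw [hπ, LinearMap.lsmul_apply, Submodule.coe_smul_of_tower, Submodule.mkQ_apply,
        ZeroMemClass.coe_zero, Submodule.Quotient.mk_eq_zero]
      exact ⟨(y : Y), rfl⟩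
  let e : (Y₀ ⧸ LinearMap.range (LinearMap.lsmul ℤ Y₀ p)) ≃ₗ[ℤ] Y₀' :=
    (Submodule.quotEquivOfEq _ _ hπker.symm).trans (π.quotKerEquivOfSurjective hπsurj)
  refine Nat.card_congr
    { toFun := fun h => e.symm.toLinearMap.toAddMonoidHom.comp h
      invFun := fun h => e.toLinearMap.toAddMonoidHom.comp h
      left_inv := fun h => AddMonoidHom.ext fun z => e.apply_symm_apply (h z)
      right_inv := fun h => AddMonoidHom.ext fun z => e.symm_apply_apply (h z) }

end ModPRepCount

/-! ### The normal-basis lattice in `𝒪_E` -/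

namespace LocalIntegers

open Representation

variable {K : Type*} [Field K] {E : Type*} [Field E] [Algebra K E] [ValuativeRel E]
  [TopologicalSpace E] [IsNonarchimedeanLocalField E]
variable (p : ℕ) [hp : Fact p.Prime]

omit hp [TopologicalSpace E] [IsNonarchimedeanLocalField E] in
/-- **`𝒪_E` as a membership-characterised `ℤ`-submodule of `E`.** [folklore] -/
theorem exists_submodule_integer :
    ∃ O : Submodule ℤ E, ∀ x : E, x ∈ O ↔ x ∈ 𝒪[E] :=
  ⟨AddSubgroup.toIntSubmodule (𝒪[E]).toAddSubgroup, fun _ => Iff.rfl⟩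

omit hp [TopologicalSpace E] [IsNonarchimedeanLocalField E] in
/-- **`𝒪_E` is `Gal(E/K)`-stable** when the Galois group preserves the valuation. [folklore] -/
theorem integer_le_comap
    (hσ : ∀ (σ : E ≃ₐ[K] E) (x : E), ValuativeRel.valuation E (σ x) = ValuativeRel.valuation E x)
    (O : Submodule ℤ E) (hO : ∀ x, x ∈ O ↔ x ∈ 𝒪[E]) (σ : E ≃ₐ[K] E) :
    O ≤ O.comap (Representation.ofDistribMulAction ℤ (E ≃ₐ[K] E) E σ) := fun x hx => by
  rw [Submodule.mem_comap, Representation.ofDistribMulAction_apply_apply, hO]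
  exact OneUnits.map_mem_integer (hσ σ) ((hO x).1 hx)

omit hp [TopologicalSpace E] [IsNonarchimedeanLocalField E] in
/-- **`𝒪_K = K ∩ 𝒪_E` as a membership-characterised `ℤ`-submodule of `K`** (for a subfield `K`
of the valued field `E`: `a ∈ 𝒪_K ↔ |a|_E ≤ 1`). [folklore] -/
theorem exists_submodule_integerBase :
    ∃ OK : Submodule ℤ K, ∀ a : K, a ∈ OK ↔ algebraMap K E a ∈ 𝒪[E] :=
  ⟨AddSubgroup.toIntSubmodule ((𝒪[E]).comap (algebraMap K E)).toAddSubgroup, fun _ => Iff.rfl⟩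

/-- For `d ∈ E` non-zero there is `m` with `|p^m| < |d|` (`⋂_m p^m 𝒪_E = 0`, characteristic `0`).
[folklore] -/
theorem exists_valuation_pow_lt [CharZero E] (hpv : ValuativeRel.valuation E p < 1) {d : E}
    (hd : d ≠ 0) :
    ∃ m : ℕ, ValuativeRel.valuation E ((p : E) ^ m) < ValuativeRel.valuation E d := by
  by_contra h
  simp only [not_exists, not_lt] at h
  have hdO : d ∈ 𝒪[E] := by
    have h0 := h 0
    rw [pow_zero, map_one] at h0
    exact (Valuation.mem_integer_iff _ _).2 h0
  have hall : ∀ m : ℕ, (⟨d, hdO⟩ : 𝒪[E]) ∈ Ideal.span {((p : 𝒪[E]) ^ m)} := fun m =>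
    OneUnits.mem_span_pow_of_valuation_le p hp.out.ne_zero m ⟨d, hdO⟩ (h m)
  exact hd (congrArg Subtype.val ((OneUnits.integer_hypotheses p hpv).2.2.2 ⟨d, hdO⟩ hall))

/-- Every `y ∈ E` satisfies `p^n y ∈ 𝒪_E` for some `n` (`|p| < 1`). [folklore] -/
theorem exists_pow_mul_mem_integer [CharZero E] (hpv : ValuativeRel.valuation E p < 1) (y : E) :
    ∃ n : ℕ, (p : E) ^ n * y ∈ 𝒪[E] := by
  by_cases hy : y = 0
  · exact ⟨0, by rw [hy, mul_zero]; exact Subring.zero_mem _⟩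
  obtain ⟨n, hn⟩ := exists_valuation_pow_lt p hpv (inv_ne_zero hy)
  refine ⟨n, (Valuation.mem_integer_iff _ _).2 ?_⟩
  rw [map_mul]
  rw [map_inv₀] at hn
  have hvy : ValuativeRel.valuation E y ≠ 0 := (Valuation.ne_zero_iff _).2 hy
  calc ValuativeRel.valuation E ((p : E) ^ n) * ValuativeRel.valuation E y
      ≤ (ValuativeRel.valuation E y)⁻¹ * ValuativeRel.valuation E y :=
        mul_le_mul' hn.le le_rfl
    _ = 1 := inv_mul_cancel₀ hvy

section NormalBasis

variable [FiniteDimensional K E] [IsGalois K E]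

/-- **An integral normal basis**: there is `x ∈ 𝒪_E` whose Galois conjugates `(σx)_σ` form a
`K`-basis of `E` (the normal basis theorem, scaled by a power of `p`). [folklore] -/
theorem exists_integral_normalBasis [CharZero E] (hpv : ValuativeRel.valuation E p < 1) :
    ∃ x : E, x ∈ 𝒪[E] ∧ ∃ b : Module.Basis (E ≃ₐ[K] E) K E, ∀ σ, b σ = σ x := by
  classical
  let b₀ := IsGalois.normalBasis K E
  obtain ⟨n, hn⟩ := exists_pow_mul_mem_integer p hpv (b₀ 1)
  have hp0 : (p : K) ^ n ≠ 0 := by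
    have : (p : E) ^ n ≠ 0 := pow_ne_zero _ (Nat.cast_ne_zero.2 hp.out.ne_zero)
    intro h
    apply this
    have := congrArg (algebraMap K E) h
    simpa using this
  have hli : LinearIndependent K fun σ : E ≃ₐ[K] E => σ (((p : K) ^ n) • b₀ 1) := by
    have h := b₀.linearIndependent.units_smul fun _ => Units.mk0 _ hp0
    convert h using 1
    funext σ
    rw [Pi.smul_apply', Units.smul_def, Units.val_mk0, IsGalois.normalBasis_apply σ,
      Algebra.smul_def, Algebra.smul_def, map_mul, AlgEquiv.commutes]
  have hcard : Fintype.card (E ≃ₐ[K] E) = Module.finrank K E :=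
    Fintype.card_eq_nat_card.trans (IsGalois.card_aut_eq_finrank K E)
  refine ⟨((p : K) ^ n) • b₀ 1, ?_, basisOfLinearIndependentOfCardEqFinrank hli hcard, fun σ => ?_⟩
  · rw [Algebra.smul_def, map_pow, map_natCast]; exact hn
  · rw [coe_basisOfLinearIndependentOfCardEqFinrank]

omit hp [ValuativeRel E] [TopologicalSpace E] [IsNonarchimedeanLocalField E] [FiniteDimensional K E]
  [IsGalois K E] in
/-- **Dedekind**: for `x` with `(σx)_σ` a `K`-basis of `E`, the matrix `(τ(σx))_{τ,σ}` has non-zero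
determinant (a row relation `∑_τ a_τ τ = 0` on the basis contradicts the `E`-linear independence of
the automorphisms `τ`, Mathlib `linearIndependent_toLinearMap`). [folklore] -/
theorem det_conjugates_ne_zero [Fintype (E ≃ₐ[K] E)] [DecidableEq (E ≃ₐ[K] E)] {x : E}
    (b : Module.Basis (E ≃ₐ[K] E) K E) (hb : ∀ σ, b σ = σ x) :
    (Matrix.of fun τ σ : E ≃ₐ[K] E => τ (σ x)).det ≠ 0 := by
  set A : Matrix (E ≃ₐ[K] E) (E ≃ₐ[K] E) E := Matrix.of fun τ σ : E ≃ₐ[K] E => τ (σ x) with hA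
  suffices h : IsUnit A from ((Matrix.isUnit_iff_isUnit_det A).1 h).ne_zero
  rw [← Matrix.vecMul_injective_iff_isUnit]
  -- Dedekind independence of `τ ↦ τ.toLinearMap`
  have hind : LinearIndependent E fun τ : E ≃ₐ[K] E => (τ : E →ₐ[K] E).toLinearMap :=
    (linearIndependent_toLinearMap K E E).comp (fun τ : E ≃ₐ[K] E => (τ : E →ₐ[K] E))
      fun τ τ' h => AlgEquiv.ext fun y => DFunLike.congr_fun h y
  intro a a' haa'
  have haa : Matrix.vecMul a A = Matrix.vecMul a' A := haa'
  rw [← sub_eq_zero]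
  have h0 : Matrix.vecMul (a - a') A = 0 := by rw [Matrix.sub_vecMul, haa, sub_self]
  funext τ
  rw [Pi.zero_apply]
  refine Fintype.linearIndependent_iff.1 hind (a - a') ?_ τ
  -- `∑_τ (a - a')_τ • τ = 0` as a `K`-linear map: check on the basis `σx`
  refine b.ext fun σ => ?_
  have h1 := congrFun h0 σ
  change ∑ τ, (a - a') τ * τ (σ x) = 0 at h1
  rw [hb, LinearMap.zero_apply, LinearMap.coe_sum, Finset.sum_apply]
  simp only [LinearMap.smul_apply, AlgHom.toLinearMap_apply, smul_eq_mul]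
  exact h1

omit hp [TopologicalSpace E] [IsNonarchimedeanLocalField E] [FiniteDimensional K E] [IsGalois K E] in
/-- Coordinates of an integral element: if `y = ∑_σ c_σ σx` with `x, y ∈ 𝒪_E` and the Galois group
preserves `𝒪_E`, then `det(τσx) · c_ρ ∈ 𝒪_E` for every `ρ` (Cramer: `det A · c = adj(A) (τy)_τ`).
[folklore] -/
theorem det_mul_coord_mem_integer [Fintype (E ≃ₐ[K] E)] [DecidableEq (E ≃ₐ[K] E)]
    (hσ : ∀ (σ : E ≃ₐ[K] E) (x : E), ValuativeRel.valuation E (σ x) = ValuativeRel.valuation E x)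
    {x y : E} (hx : x ∈ 𝒪[E]) (hy : y ∈ 𝒪[E]) (c : (E ≃ₐ[K] E) → K)
    (hyc : y = ∑ σ, c σ • σ x) (ρ : E ≃ₐ[K] E) :
    (Matrix.of fun τ σ : E ≃ₐ[K] E => τ (σ x)).det * algebraMap K E (c ρ) ∈ 𝒪[E] := by
  set A : Matrix (E ≃ₐ[K] E) (E ≃ₐ[K] E) E := Matrix.of fun τ σ : E ≃ₐ[K] E => τ (σ x) with hA
  -- the integral avatars
  let A' : Matrix (E ≃ₐ[K] E) (E ≃ₐ[K] E) 𝒪[E] :=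
    Matrix.of fun τ σ => ⟨τ (σ x), OneUnits.map_mem_integer (hσ τ) (OneUnits.map_mem_integer (hσ σ) hx)⟩
  let w' : (E ≃ₐ[K] E) → 𝒪[E] := fun τ => ⟨τ y, OneUnits.map_mem_integer (hσ τ) hy⟩
  have hAA' : A = (𝒪[E]).subtype.mapMatrix A' := by
    ext τ σ; rfl
  -- `A (algebraMap ∘ c) = (τ y)_τ`
  have hmul : A.mulVec (fun σ => algebraMap K E (c σ)) = fun τ => τ y := by
    funext τ
    change ∑ σ, A τ σ * algebraMap K E (c σ) = τ y
    rw [hyc, map_sum]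
    refine Finset.sum_congr rfl fun σ _ => ?_
    rw [hA, Matrix.of_apply, Algebra.smul_def, map_mul, AlgEquiv.commutes, mul_comm]
  -- Cramer: `adj(A) (A c) = det A • c`
  have hcr : A.adjugate.mulVec (fun τ => τ y) = A.det • fun σ => algebraMap K E (c σ) := by
    rw [← hmul, Matrix.mulVec_mulVec, Matrix.adjugate_mul, Matrix.smul_mulVec,
      Matrix.one_mulVec]
  have hρ : A.det * algebraMap K E (c ρ) = A.adjugate.mulVec (fun τ => τ y) ρ := by
    have h := congrFun hcr ρ
    rw [Pi.smul_apply, smul_eq_mul] at h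
    exact h.symm
  -- integrality of `adj(A) (τ y)_τ`
  have hadj : A.adjugate = (𝒪[E]).subtype.mapMatrix A'.adjugate := by
    rw [RingHom.map_adjugate, ← hAA']
  have hw : (fun τ => τ y) = (𝒪[E]).subtype ∘ w' := by funext τ; rfl
  rw [hρ, hadj, hw, RingHom.mapMatrix_apply, ← RingHom.map_mulVec]
  exact SetLike.coe_mem _

/-- **The normal-basis lattice**: for `E/K` finite Galois with `E` a non-archimedean local field of
characteristic `0`, `|p| < 1`, and `Gal(E/K)` preserving the valuation, there are `x ∈ 𝒪_E` with
`(σx)_σ` a `K`-basis of `E` and `N` such that every `y ∈ 𝒪_E` has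
`p^N y = ∑_σ a_σ σx` with all `a_σ ∈ 𝒪_K = K ∩ 𝒪_E` — i.e. `p^N 𝒪_E ≤ ⊕_σ 𝒪_K σx ≤ 𝒪_E`
("`R_L ⊇` a normal-basis lattice of finite index", the input of Lemma 2.12 in Milne's proof of
I Thm. 2.8). [cite: MilneADT2006, I §2 proof of Thm 2.8 (p. 34)] -/
theorem exists_normalBasis_lattice [CharZero E] (hpv : ValuativeRel.valuation E p < 1)
    (hσ : ∀ (σ : E ≃ₐ[K] E) (x : E), ValuativeRel.valuation E (σ x) = ValuativeRel.valuation E x) :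
    ∃ x : E, x ∈ 𝒪[E] ∧ (∃ b : Module.Basis (E ≃ₐ[K] E) K E, ∀ σ, b σ = σ x) ∧
      ∃ N : ℕ, ∀ y ∈ 𝒪[E], ∃ a : (E ≃ₐ[K] E) → K,
        (∀ σ, algebraMap K E (a σ) ∈ 𝒪[E]) ∧ (p : E) ^ N * y = ∑ σ, algebraMap K E (a σ) * σ x := by
  classical
  obtain ⟨x, hx, b, hb⟩ := exists_integral_normalBasis p hpv (K := K) (E := E)
  refine ⟨x, hx, ⟨b, hb⟩, ?_⟩
  set A : Matrix (E ≃ₐ[K] E) (E ≃ₐ[K] E) E := Matrix.of fun τ σ : E ≃ₐ[K] E => τ (σ x) with hA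
  have hdet : A.det ≠ 0 := det_conjugates_ne_zero b hb
  obtain ⟨N, hN⟩ := exists_valuation_pow_lt p hpv hdet
  refine ⟨N, fun y hy => ?_⟩
  -- coordinates
  let c : (E ≃ₐ[K] E) → K := fun σ => b.repr y σ
  have hyc : y = ∑ σ, c σ • σ x := by
    conv_lhs => rw [← b.sum_repr y]
    exact Finset.sum_congr rfl fun σ _ => by rw [hb]
  refine ⟨fun σ => (p : K) ^ N * c σ, fun σ => ?_, ?_⟩
  · -- `|p^N c_σ| ≤ 1` from `|det A · c_σ| ≤ 1` and `|p^N| < |det A|`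
    have hint := det_mul_coord_mem_integer hσ hx hy c hyc σ
    rw [Valuation.mem_integer_iff, map_mul] at hint
    rw [map_mul, map_pow, map_natCast, Valuation.mem_integer_iff, map_mul]
    by_cases hc0 : ValuativeRel.valuation E (algebraMap K E (c σ)) = 0
    · rw [hc0, mul_zero]; exact zero_le_one
    · calc ValuativeRel.valuation E ((p : E) ^ N) * ValuativeRel.valuation E (algebraMap K E (c σ))
          ≤ ValuativeRel.valuation E A.det * ValuativeRel.valuation E (algebraMap K E (c σ)) :=
            mul_le_mul' hN.le le_rfl
        _ ≤ 1 := hint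
  · rw [hyc, Finset.mul_sum]
    refine Finset.sum_congr rfl fun σ _ => ?_
    rw [map_mul, map_pow, map_natCast, Algebra.smul_def, mul_assoc]

end NormalBasis

end LocalIntegers

end Summit.BirchSwinnertonDyer.Rank1Residual.GaloisImage

end
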